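/-
Copyright (c) 2026. All rights reserved.
Released under Apache 2.0 license as described in the file LICENSE.
Authors: abc-iut cell, prover seat abc-iut-f-102 (F fact-proving wave, gen 3).
-/
import Literature.AnabelianGeometry.AbsoluteAnabelian.LogFrobeniusRealisesRelLifts
import Literature.AnabelianGeometry.AbsoluteAnabelian.LogFrobeniusShiftActionOfRealises
import Literature.AnabelianGeometry.AbsoluteAnabelian.LogFrobeniusCor55FamiliesDiagonal
import HarnessLib

/-!
# [AbsTopIII] Cor 5.5 (i)/(iii)/(v): THEOREM B — a family of homotopies on `D•⊢` realising cores and observables (F-0159, sufficiency)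

S. Mochizuki, *Topics in absolute anabelian geometry III: global reconstruction algorithms*,
J. Math. Sci. Univ. Tokyo 22 (2015) 939–1156 [MochizukiAbsTopIII2015]; locators `p.N` = pages of the author's
manuscript (`paper:url-5493eb38cbb7`), read on the page: Cor 5.5 (i) p. 130 ("`D•_{≤n}` admits a natural structure of
core on `D•_{≤n-1}`"), (iii) p. 131 (the observables `S_log⊞`, "compatible with one another as well as with the families
of homotopies that constitute the core and telecore structures"), (v) pp. 131–133, Def 3.5 (ii)/(iii) p. 75.

THEOREM B of the f-102 lineage (FACT-LIST F-0159 `RealisesCor55Families`, hence F-0157 `Cor55ShiftAction` by gen 2's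
THEOREM A `cor55ShiftAction_iff_exists_realisesCor55Families` and F-0156): **SUFFICIENCY.**  For a setting `L` over a
NONEMPTY index set whose `ι⊞`-squares commute (abc-iut-f-101's `IotaSquaresCommute`, equivalent to Cor 5.5 (iii)) and
whose `ι⊞_{v,ε}` LIE OVER `Th•[Z]` with respect to SOME over-data `A_ν : λ⊞_{v,ν} ⋙ (𝒩⊞_v → ℰ•) ≅ proj`,
`Ξ : log ⋙ proj ≅ proj` (hypotheses Pre/Post of toolkit 3/4), the family of homotopies `K := relFamily (realisesRelLifts …)`
on `D•⊢` (toolkit 4/4, abc-iut-f-101's constructor) REALISES the three cores of Cor 5.5 (i) and the observables `S_log⊞_v`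
of Cor 5.5 (iii) — all embedded in `K` ("compatible with one another"): `realisesCor55Families_realisingFamily`,
`exists_realisesCor55Families_of_over`; consequently `Cor55ShiftAction` (`cor55ShiftAction_of_over`).  In print both
hypotheses hold (Def 5.4 (iii) commutativity; Def 5.4 (iv)/(ii) "lies over `Th•[Z]`" with `A := lamOver`, `Ξ := logOver`
once recorded for the `ι⊞`): the print-faithful instance is `cor55ShiftAction_of_iotaOver` (conclusion
`(∃ K, RealisesCor55Families K) ∧ Cor55ShiftAction`; its hypotheses `hpre`/`hpost` are "`ι⊞` lies over `Th•[Z]`" in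
COMPONENT form — abc-iut-L4-t3's add-on laws `IotaOver ∧ LamOverLink` supply them via `IotaOver.toE_map_iota_heq_of_preLog`
/ `IotaOver.toE_map_iota_heq_spaceLink` (`LogFrobeniusLamOverLink`), composed and fired at the genuine carriers in
`LogFrobeniusGenuineCor55ShiftAction`).

The sub-structures are cut out of `K` along the embeddings `Γ⃗_{D_{≤P} ∪ {x}} ↪ Γ⃗_{D•⊢}` (abc-iut-L4-t5's `comap`,
abc-iut-w4-d095's identification of the presentations, abc-iut-L4-t12's `restrictBoundary`).  Hypotheses only; no claim of
the paper is asserted.  Refereed pre-IUT material; nothing here bears on [IUTchIII] Cor. 3.12; typed ≠ proved.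
-/

set_option autoImplicit false

universe u

open CategoryTheory Quiver

namespace Literature.AnabelianGeometry.AbsoluteAnabelian

/-! ## Bookkeeping -/

section HEqLemmas

/-- Components along equalities of the source and target functors differ by `eqToHom`s. [folklore] -/
private theorem app_eq_of_heq' {A B : Type*} [Category A] [Category B] {F G F' G' : A ⥤ B} (hF : F = F') (hG : G = G')
    {α : F ⟶ G} {β : F' ⟶ G'} (h : α ≍ β) (x : A) :
    β.app x = eqToHom (by rw [hF]) ≫ α.app x ≫ eqToHom (by rw [hG]) := by
  subst hF hG
  cases h
  simp

/-- Merging `eqToHom` book-ends around a morphism (free endpoints). [folklore] -/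
private theorem eqToHom_conj₅ {C : Type*} [Category C] {a₀ a₁ a₂ a₃ b₃ b₂ b₁ b₀ : C} (p₁ : a₀ = a₁) (p₂ : a₁ = a₂)
    (p₃ : a₂ = a₃) (g : a₃ ⟶ b₃) (q₃ : b₃ = b₂) (q₂ : b₂ = b₁) (q₁ : b₁ = b₀) (s : a₀ = a₃) (t : b₃ = b₀) :
    eqToHom p₁ ≫ (eqToHom p₂ ≫ (eqToHom p₃ ≫ g ≫ eqToHom q₃) ≫ eqToHom q₂) ≫ eqToHom q₁ =
      eqToHom s ≫ g ≫ eqToHom t := by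
  cases p₁; cases p₂; cases p₃; cases q₃; cases q₂; cases q₁
  simp

/-- Merging `eqToHom` book-ends around a morphism, four levels (free endpoints). [folklore] -/
private theorem eqToHom_conj₇ {C : Type*} [Category C] {a₀ a₁ a₂ a₃ a₄ b₄ b₃ b₂ b₁ b₀ : C} (p₁ : a₀ = a₁)
    (p₂ : a₁ = a₂) (p₃ : a₂ = a₃) (p₄ : a₃ = a₄) (g : a₄ ⟶ b₄) (q₄ : b₄ = b₃) (q₃ : b₃ = b₂) (q₂ : b₂ = b₁)
    (q₁ : b₁ = b₀) (s : a₀ = a₄) (t : b₄ = b₀) :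
    eqToHom p₁ ≫ (eqToHom p₂ ≫ (eqToHom p₃ ≫ (eqToHom p₄ ≫ g ≫ eqToHom q₄) ≫ eqToHom q₃) ≫ eqToHom q₂) ≫ eqToHom q₁ =
      eqToHom s ≫ g ≫ eqToHom t := by
  cases p₁; cases p₂; cases p₃; cases p₄; cases q₄; cases q₃; cases q₂; cases q₁
  simp

end HEqLemmas

namespace LogFrobeniusSetting

variable {Vmod : Type u} {isArc : Vmod → Bool} (L : LogFrobeniusSetting Vmod isArc)

/-! ## Sub-structures of a family on `D•⊢` along the presentations `D_{≤P} ∪ {x}` -/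

/-- abc-iut-w4-d095's identification: the presentation `D_{≤P} ∪ {x}` IS the diagram pulled back along the embedding
`Γ⃗_{D_{≤P} ∪ {x}} ↪ Γ⃗_{D•⊢}`. [cite: MochizukiAbsTopIII2015, Definition 3.5 (i) p.74] -/
theorem extend_eq_comapAlong (P : DVertex Vmod isArc → Prop) (x : DVertex Vmod isArc) :
    (L.subdiagram P).extend (L.obsExt P x) = L.diagram.comapAlong (embExt P x) :=
  DiagramOfCategories.eq_comapAlong L.diagram (embExt P x) (L.obj_extend_eq P x) (L.cat_extend_heq P x)
    (fun e => L.map_extend_heq P x e)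

/-- The family `K|_{D_{≤P} ∪ {x}}` pulled back to the presentation (abc-iut-L4-t5's `comap`, transported).
[cite: MochizukiAbsTopIII2015, Definition 3.5 (ii) p.75] -/
def comapExt (K : L.diagram.HomotopyFamily) (P : DVertex Vmod isArc → Prop) (x : DVertex Vmod isArc) :
    ((L.subdiagram P).extend (L.obsExt P x)).HomotopyFamily :=
  (L.extend_eq_comapAlong P x).symm ▸ K.comap (embExt P x)

/-- Its boundary pairs are the pairs whose images are boundary pairs of `K`. [cite: MochizukiAbsTopIII2015, Definition 3.5 (ii) p.75] -/
theorem comapExt_E_iff (K : L.diagram.HomotopyFamily) (P : DVertex Vmod isArc → Prop) (x : DVertex Vmod isArc)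
    {a b : (obsShape P x).Vertex} (p q : Path a b) :
    (L.comapExt K P x).E p q ↔ K.E ((embExt P x).mapPath p) ((embExt P x).mapPath q) :=
  DiagramOfCategories.HomotopyFamily.cast_E_iff _ _ p q

/-- It is compatible with `K` along the embedding. [cite: MochizukiAbsTopIII2015, Definition 3.5 (ii) p.75] -/
theorem comapExt_compatible (K : L.diagram.HomotopyFamily) (P : DVertex Vmod isArc → Prop) (x : DVertex Vmod isArc)
    {a b : (obsShape P x).Vertex} (p q : Path a b) (h : (L.comapExt K P x).E p q) :
    ∃ h' : K.E ((embExt P x).mapPath p) ((embExt P x).mapPath q), (L.comapExt K P x).η h ≍ K.η h' :=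
  K.cast_comap_compatible (embExt P x) (L.extend_eq_comapAlong P x).symm p q h

/-- The restriction of `K|_{D_{≤P} ∪ {x}}` to its boundary pairs ending at the observation vertex (an observable family).
[cite: MochizukiAbsTopIII2015, Definition 3.5 (iii) p.75] -/
def obsRestrict (K : L.diagram.HomotopyFamily) (P : DVertex Vmod isArc → Prop) (x : DVertex Vmod isArc) :
    ((L.subdiagram P).extend (L.obsExt P x)).HomotopyFamily :=
  (L.comapExt K P x).restrictBoundary (fun _ b p q => b = (obsShape P x).obs ∧ (L.comapExt K P x).E p q)
    ((DiagramOfCategories.isSaturated_endsAt_obs (obsShape P x) (fun _ => (inferInstance : IsEmpty PEmpty.{u + 1}))).inter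
      (L.comapExt K P x).isSaturated)
    (fun _ _ _ _ h => h.2)

/-- Every boundary path of the restriction ends at the observation vertex. [cite: MochizukiAbsTopIII2015, Definition 3.5 (iii) p.75] -/
theorem obsRestrict_terminal (K : L.diagram.HomotopyFamily) (P : DVertex Vmod isArc → Prop) (x : DVertex Vmod isArc) :
    ∀ ⦃a b : (obsShape P x).Vertex⦄ ⦃p q : Path a b⦄, (L.obsRestrict K P x).E p q → b = (obsShape P x).obs :=
  fun _ _ _ _ h => h.1

/-- The restriction is compatible with `K` (Def 3.5 (ii) "compatible families", across the embedding).
[cite: MochizukiAbsTopIII2015, Cor 5.5 (iv) p. 131] -/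
theorem obsRestrict_compatibleIn (K : L.diagram.HomotopyFamily) (P : DVertex Vmod isArc → Prop) (x : DVertex Vmod isArc) :
    L.CompatibleIn K (L.obsRestrict K P x) :=
  fun _ _ p q h => L.comapExt_compatible K P x p q h.2

/-- **A family on `D•⊢` containing every co-verticial pair of paths into `x` realises the core of `D_{≤P} ∪ {x}` on `D_{≤P}`**
(Def 3.5 (iii)), as soon as every vertex of `D_{≤P}` reaches `x`. [cite: MochizukiAbsTopIII2015, Cor 5.5 (i) p. 130] -/
theorem isCoreOnIn_of_forall_E (K : L.diagram.HomotopyFamily) (P : DVertex Vmod isArc → Prop) (x : DVertex Vmod isArc)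
    (hK : ∀ {a : DVertex Vmod isArc} (p q : Path a x), K.E p q)
    (hreach : ∀ a : DSub P, Nonempty (Path ((obsShape P x).base a) (obsShape P x).obs)) : L.IsCoreOnIn K P x := by
  refine ⟨L.obsRestrict K P x, L.obsRestrict_terminal K P x, ⟨fun a p q => ?_, hreach⟩, L.obsRestrict_compatibleIn K P x⟩
  exact ⟨rfl, (L.comapExt_E_iff K P x p q).mpr (hK _ _)⟩

/-! ## THEOREM B: the generated family realises cores and observables -/

section TheoremB

variable (A : ∀ (v : Vmod) (ν : LogVertex (isArc v)), ν.isPostLog = false → (L.lam v ν ⋙ L.forget v ⋙ L.toE v ≅ L.proj))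
  (Ξ : L.log ⋙ L.proj ≅ L.proj) (hsq : ∀ v, L.IotaSquaresCommute v)
  (hpre : ∀ (v : Vmod) (ν₁ ν₂ : LogVertex (isArc v)) (ε : LogEdge (isArc v) ν₁ ν₂) (h₁ : ν₁.isPostLog = false)
    (h₂ : ν₂.isPostLog = false) (X₀ : L.X), (L.toE v).map ((L.forget v).map ((L.iota v ε).app X₀)) ≍
    ((A v ν₁ h₁).hom.app X₀ ≫ (A v ν₂ h₂).inv.app X₀))
  (hpost : ∀ (v : Vmod) (ν₁ ν₂ : LogVertex (isArc v)) (ε : LogEdge (isArc v) ν₁ ν₂) (_ : ν₁.isPostLog = true)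
    (h₂ : ν₂.isPostLog = false) (hsl : (LogVertex.spaceLink (isArc v)).isPostLog = false) (X₀ : L.X),
    (L.toE v).map ((L.forget v).map ((L.iota v ε).app X₀)) ≍
    ((A v _ hsl).hom.app (L.log.obj X₀) ≫ Ξ.hom.app X₀ ≫ (A v ν₂ h₂).inv.app X₀))

/-- `ℰ•` is a pivot. [cite: MochizukiAbsTopIII2015, Cor 5.5 (i) p. 130] -/
theorem e5_isPivot : IsPivot (DVertex.e5 : DVertex Vmod isArc) := trivial

/-- `An•[𝒳]` is a pivot. [cite: MochizukiAbsTopIII2015, Cor 5.5 (i) p. 130] -/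
theorem an_isPivot : IsPivot (DVertex.an : DVertex Vmod isArc) := trivial

/-- the `ℰ•` of row 7 is a pivot. [cite: MochizukiAbsTopIII2015, Cor 5.5 (i) p. 130] -/
theorem e7_isPivot : IsPivot (DVertex.e7 : DVertex Vmod isArc) := trivial

/-- `𝒩⊞_v` is a pivot. [cite: MochizukiAbsTopIII2015, Cor 5.5 (iii) p. 131] -/
theorem nplus_isPivot (v : Vmod) : IsPivot (DVertex.nplus v : DVertex Vmod isArc) := trivial

/-- **The family of homotopies of THEOREM B** on `D•⊢`: abc-iut-f-101's `relFamily` of the relative-lift datum of toolkit 4/4.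
[cite: MochizukiAbsTopIII2015, Cor 5.5 (iii) p. 131] -/
noncomputable def realisingFamily : L.diagram.HomotopyFamily :=
  DiagramOfCategories.relFamily (L.realisesRelLifts A Ξ hsq hpre hpost)

/-- Every co-verticial pair of paths of `Γ⃗_{D•⊢}` into a core vertex is a boundary pair of the family (Def 3.5 (iii): a core
relates ALL such pairs). [cite: MochizukiAbsTopIII2015, Definition 3.5 (iii) pp.75–76] -/
theorem realisingFamily_E_of_isCoreVertex {a x : DVertex Vmod isArc} (hx : IsCoreVertex x) (p q : Path a x) :
    (L.realisingFamily A Ξ hsq hpre hpost).E p q := by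
  let R := L.realisesRelLifts A Ξ hsq hpre hpost
  show DiagramOfCategories.relE R p q
  cases x
  case e5 => exact DiagramOfCategories.relE_of_rel R (w := DVertex.e5) trivial (p := p) (q := q) trivial
  case an => exact DiagramOfCategories.relE_of_rel R (w := DVertex.an) trivial (p := p) (q := q) trivial
  case e7 => exact DiagramOfCategories.relE_of_rel R (w := DVertex.e7) trivial (p := p) (q := q) trivial
  all_goals exact hx.elim

/-- The generator pairs of Cor 5.5 (iii) are boundary pairs of the family, with homotopy the generator's (the chain of ONE
move; coherence `lchain_hom_eq`). [cite: MochizukiAbsTopIII2015, Cor 5.5 (iii) p. 131] -/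
theorem realisingFamily_η_lgen (v : Vmod) {c : DVertex Vmod isArc} {g g' : Path c (DVertex.nplus v)}
    (s : LGen (isArc := isArc) v g g') :
    ∃ h : (L.realisingFamily A Ξ hsq hpre hpost).E g g',
      (L.realisingFamily A Ξ hsq hpre hpost).η h =
        L.diagram.moveHom Path.nil (L.lgenHom v s) (Path.nil_comp g).symm (Path.nil_comp g').symm := by
  let m : DiagramOfCategories.Move (LGen (isArc := isArc) v) g g' :=
    ⟨c, Path.nil, g, g', s, (Path.nil_comp g).symm, (Path.nil_comp g').symm⟩
  have hrel : PivotRel g g' := ⟨DiagramOfCategories.Chain.cons m (DiagramOfCategories.Chain.nil g')⟩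
  let R := L.realisesRelLifts A Ξ hsq hpre hpost
  refine ⟨show DiagramOfCategories.relE R g g' from
    DiagramOfCategories.relE_of_rel R (w := DVertex.nplus v) trivial hrel, ?_⟩
  unfold realisingFamily
  rw [DiagramOfCategories.relFamily_η_eq_θ _ (nplus_isPivot (isArc := isArc) v) hrel]
  show (Classical.choice hrel).hom (L.lgenHom v) = _
  rw [L.lchain_hom_eq v (hsq v) (Classical.choice hrel)
    (DiagramOfCategories.Chain.cons m (DiagramOfCategories.Chain.nil g')),
    DiagramOfCategories.Chain.hom_cons, DiagramOfCategories.Chain.hom_nil, Category.comp_id]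
  rfl

/-- the path functor of `[λ⊞_ν]` in the presentation `D•_{≤2} ∪ {𝒩⊞_v}` is the one in `D•⊢`.
[cite: MochizukiAbsTopIII2015, Definition 3.5 (i) p.75] -/
theorem pathFunctor_lamPath_eq_lamP (v : Vmod) (ν : LogVertex (isArc v)) (hν : ν.isPostLog = false) :
    (L.logDiagramPlus v).pathFunctor (lamPath v ν hν) = L.diagram.pathFunctor (lamP v ν hν) := by
  simp only [lamPath, lamP, DiagramOfCategories.pathFunctor_cons, DiagramOfCategories.pathFunctor_nil]
  rfl

/-- the path functor of `[λ⊞_{sl}]∘[id_⋎]∘[log]` in the presentation is the one in `D•⊢`.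
[cite: MochizukiAbsTopIII2015, Definition 3.5 (i) p.75] -/
theorem pathFunctor_postLogDomPath_eq_postDomP (v : Vmod) (n : ℤ) (hsl : (LogVertex.spaceLink (isArc v)).isPostLog = false) :
    (L.logDiagramPlus v).pathFunctor (postLogDomPath v n hsl) = L.diagram.pathFunctor (postDomP v n hsl) := by
  simp only [postLogDomPath, postDomP, DiagramOfCategories.pathFunctor_cons, DiagramOfCategories.pathFunctor_nil]
  rfl

/-- the path functor of `[λ⊞_{ν₂}]∘[id_{⋎+1}]` in the presentation is the one in `D•⊢`.
[cite: MochizukiAbsTopIII2015, Definition 3.5 (i) p.75] -/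
theorem pathFunctor_postLogCodPath_eq_postCodP (v : Vmod) (n : ℤ) (ν₂ : LogVertex (isArc v)) (h₂ : ν₂.isPostLog = false) :
    (L.logDiagramPlus v).pathFunctor (postLogCodPath v n ν₂ h₂) = L.diagram.pathFunctor (postCodP v n ν₂ h₂) := by
  simp only [postLogCodPath, postCodP, DiagramOfCategories.pathFunctor_cons, DiagramOfCategories.pathFunctor_nil]
  rfl

/-- **The observable `S_log⊞_v` of Cor 5.5 (iii) is realised INSIDE the family**: the restriction of `K|_{D•_{≤2} ∪ {𝒩⊞_v}}`
to the pairs ending at `𝒩⊞_v` is an observable as typed (`IsLogObservablePlus`: the printed pairs carry exactly the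
`ι⊞_{v,ε}`) compatible with `K`. [cite: MochizukiAbsTopIII2015, Cor 5.5 (iii) p. 131] -/
theorem exists_isLogObservablePlus_realisingFamily (v : Vmod) :
    ∃ H : (L.logDiagramPlus v).HomotopyFamily, L.IsLogObservablePlus v H ∧
      L.CompatibleIn (L.realisingFamily A Ξ hsq hpre hpost) H := by
  let K := L.realisingFamily A Ξ hsq hpre hpost
  refine ⟨L.obsRestrict K (DVertex.InFirstRows 2) (.nplus v), ⟨L.obsRestrict_terminal K _ _, ?_, ?_⟩,
    L.obsRestrict_compatibleIn K _ _⟩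
  · intro ν₁ ν₂ ε h₁ h₂
    obtain ⟨k, hk⟩ := L.realisingFamily_η_lgen A Ξ hsq hpre hpost v (LGen.pre ν₁ ν₂ ε h₁ h₂)
    have hmem : (L.obsRestrict K (DVertex.InFirstRows 2) (.nplus v)).E (lamPath v ν₁ h₁) (lamPath v ν₂ h₂) :=
      ⟨rfl, (L.comapExt_E_iff K _ _ _ _).mpr k⟩
    refine ⟨hmem, fun X₀ => ⟨Functor.congr_obj (L.pathFunctor_lamPath v ν₁ h₁) X₀,
      Functor.congr_obj (L.pathFunctor_lamPath' v ν₂ h₂) X₀, ?_⟩⟩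
    obtain ⟨k', hc⟩ := L.comapExt_compatible K (DVertex.InFirstRows 2) (.nplus v) (lamPath v ν₁ h₁) (lamPath v ν₂ h₂) hmem.2
    have e1 := app_eq_of_heq' (L.pathFunctor_lamPath_eq_lamP v ν₁ h₁).symm (L.pathFunctor_lamPath_eq_lamP v ν₂ h₂).symm
      hc.symm X₀
    have e2 : K.η k' = L.diagram.moveHom Path.nil (L.lgenHom v (LGen.pre ν₁ ν₂ ε h₁ h₂)) (Path.nil_comp _).symm
        (Path.nil_comp _).symm := hk
    have hy : (L.diagram.pathFunctor (Path.nil : Path (DVertex.core : DVertex Vmod isArc) .core)).obj X₀ = X₀ :=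
      Functor.congr_obj (L.diagram.pathFunctor_nil DVertex.core) X₀
    have e4 : ∀ y, (L.lgenHom v (LGen.pre ν₁ ν₂ ε h₁ h₂)).app y =
        eqToHom (Functor.congr_obj (L.pathFunctor_lamP v ν₁ h₁) y) ≫ (L.iota v ε).app y ≫
          eqToHom (Functor.congr_obj (L.pathFunctor_lamP' v ν₂ h₂) y) := by
      intro y
      simp only [lgenHom, NatTrans.comp_app, eqToHom_app]
    have e5 := NatTrans.congr (L.iota v ε) hy
    change ((L.comapExt K (DVertex.InFirstRows 2) (.nplus v)).η hmem.2).app X₀ = _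
    rw [e1, e2, DiagramOfCategories.moveHom_app, e4, e5]
    simp only [eqToHom_map]
    exact eqToHom_conj₇ _ _ _ _ _ _ _ _ _ _ _
  · intro ν₁ ν₂ ε h₁ h₂ hsl n
    obtain ⟨k, hk⟩ := L.realisingFamily_η_lgen A Ξ hsq hpre hpost v (LGen.post ν₁ ν₂ ε h₁ h₂ hsl n)
    have hmem : (L.obsRestrict K (DVertex.InFirstRows 2) (.nplus v)).E (postLogDomPath v n hsl)
        (postLogCodPath v n ν₂ h₂) :=
      ⟨rfl, (L.comapExt_E_iff K _ _ _ _).mpr k⟩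
    refine ⟨hmem, fun X₀ => ⟨Functor.congr_obj (L.pathFunctor_postLogDomPath v ν₁ h₁ n hsl) X₀,
      Functor.congr_obj (L.pathFunctor_postLogCodPath v n ν₂ h₂) X₀, ?_⟩⟩
    obtain ⟨k', hc⟩ := L.comapExt_compatible K (DVertex.InFirstRows 2) (.nplus v) (postLogDomPath v n hsl)
      (postLogCodPath v n ν₂ h₂) hmem.2
    have e1 := app_eq_of_heq' (L.pathFunctor_postLogDomPath_eq_postDomP v n hsl).symm
      (L.pathFunctor_postLogCodPath_eq_postCodP v n ν₂ h₂).symm hc.symm X₀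
    have e2 : K.η k' = L.diagram.moveHom Path.nil (L.lgenHom v (LGen.post ν₁ ν₂ ε h₁ h₂ hsl n)) (Path.nil_comp _).symm
        (Path.nil_comp _).symm := hk
    have hy : (L.diagram.pathFunctor
        (Path.nil : Path (DVertex.row1 (n + 1) : DVertex Vmod isArc) (.row1 (n + 1)))).obj X₀ = X₀ :=
      Functor.congr_obj (L.diagram.pathFunctor_nil (DVertex.row1 (n + 1))) X₀
    have e4 : ∀ y, (L.lgenHom v (LGen.post ν₁ ν₂ ε h₁ h₂ hsl n)).app y =
        eqToHom (Functor.congr_obj (L.pathFunctor_postDomP v ν₁ h₁ n hsl) y) ≫ (L.iota v ε).app y ≫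
          eqToHom (Functor.congr_obj (L.pathFunctor_postCodP v n ν₂ h₂) y) := by
      intro y
      simp only [lgenHom, NatTrans.comp_app, eqToHom_app]
    have e5 := NatTrans.congr (L.iota v ε) hy
    change ((L.comapExt K (DVertex.InFirstRows 2) (.nplus v)).η hmem.2).app X₀ = _
    rw [e1, e2, DiagramOfCategories.moveHom_app, e4, e5]
    simp only [eqToHom_map]
    exact eqToHom_conj₇ _ _ _ _ _ _ _ _ _ _ _

/-- **THEOREM B (sufficiency for F-0159).**  Over a NONEMPTY index set, if the `ι⊞`-squares of every `Γ⃗^log_v` commute and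
every `ι⊞_{v,ε}` lies over `Th•[Z]` w.r.t. the over-data `A`, `Ξ`, then the family `realisingFamily` on `D•⊢` realises the
cores `ℰ•`, `An•[𝒳]`, `ℰ•` of Cor 5.5 (i) and the observables `S_log⊞_v` of Cor 5.5 (iii), all compatible with one another
(`RealisesCor55Families`). [cite: MochizukiAbsTopIII2015, Cor 5.5 (iii) p. 131] -/
theorem realisesCor55Families_realisingFamily [Nonempty Vmod] :
    L.RealisesCor55Families (L.realisingFamily A Ξ hsq hpre hpost) :=
  ⟨L.isCoreOnIn_of_forall_E _ _ _ (fun p q => L.realisingFamily_E_of_isCoreVertex A Ξ hsq hpre hpost e5_isCoreVertex p q)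
      reach_e5,
    L.isCoreOnIn_of_forall_E _ _ _ (fun p q => L.realisingFamily_E_of_isCoreVertex A Ξ hsq hpre hpost an_isCoreVertex p q)
      reach_an,
    L.isCoreOnIn_of_forall_E _ _ _ (fun p q => L.realisingFamily_E_of_isCoreVertex A Ξ hsq hpre hpost e7_isCoreVertex p q)
      reach_e7,
    fun v => L.exists_isLogObservablePlus_realisingFamily A Ξ hsq hpre hpost v⟩

include A Ξ hsq hpre hpost

/-- **THEOREM B, existential form (F-0159)**: under the same hypotheses some family of homotopies on `D•⊢` realises Cor 5.5
(i)/(iii). [cite: MochizukiAbsTopIII2015, Cor 5.5 (iii) p. 131] -/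
theorem exists_realisesCor55Families_of_over [Nonempty Vmod] :
    ∃ K : L.diagram.HomotopyFamily, L.RealisesCor55Families K :=
  ⟨_, L.realisesCor55Families_realisingFamily A Ξ hsq hpre hpost⟩

/-- **Consequently the `ℤ`-action clause of Cor 5.5 (v) holds (F-0157 `Cor55ShiftAction`)**, by gen 2's THEOREM A
`cor55ShiftAction_iff_exists_realisesCor55Families`. [cite: MochizukiAbsTopIII2015, Cor 5.5 (v) pp. 131–133] -/
theorem cor55ShiftAction_of_over [Nonempty Vmod] : L.Cor55ShiftAction :=
  L.cor55ShiftAction_iff_exists_realisesCor55Families.mpr (L.exists_realisesCor55Families_of_over A Ξ hsq hpre hpost)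

/-- **… and Cor 5.5 (v) as one node (F-0156 `Cor55Rigidity`) holds iff `𝒳 = Th•_T[Z]` is id-rigid** (the total
`□`-rigidity clause, abc-iut-w5-d112's `cor55CoreRigid_iff`). [cite: MochizukiAbsTopIII2015, Cor 5.5 (v) pp. 131–133] -/
theorem cor55Rigidity_iff_isIdRigid_of_over [Nonempty Vmod] : L.Cor55Rigidity ↔ IsIdRigid L.X :=
  L.cor55Rigidity_iff_isIdRigid_and_exists.trans
    ⟨fun h => h.1, fun h => ⟨h, L.exists_realisesCor55Families_of_over A Ξ hsq hpre hpost⟩⟩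

end TheoremB

/-! ## The print-faithful instance: `ι⊞` over `Th•[Z]` w.r.t. the interface's own `lamOver`, `logOver` -/

/-- **THEOREM B at the interface's own over-structure.**  If the `ι⊞_{v,ε}` lie over `Th•[Z]` with respect to the
interface's `lamOver` ("`λ⊞_{v,ν}` lies over `Th•[Z]`", Def 5.4 (iv)) and `logOver` ("`log` lies over `Th•`", Def 5.4
(ii)) — the datum print has and the interface `LogFrobeniusSetting` does not record for `ι⊞` (gen 2's interface note
'iotaOver') — and the `ι⊞`-squares commute (Def 5.4 (iii)), then over a nonempty `V(F_mod)` the typed Cor 5.5 (i)/(iii) are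
realised in one family (F-0159) and the `ℤ`-action clause of Cor 5.5 (v) holds (F-0157).
[cite: MochizukiAbsTopIII2015, Cor 5.5 (v) pp. 131–133] -/
theorem cor55ShiftAction_of_iotaOver [Nonempty Vmod] (hsq : ∀ v, L.IotaSquaresCommute v)
    (hpre : ∀ (v : Vmod) (ν₁ ν₂ : LogVertex (isArc v)) (ε : LogEdge (isArc v) ν₁ ν₂) (_ : ν₁.isPostLog = false)
      (_ : ν₂.isPostLog = false) (X₀ : L.X), (L.toE v).map ((L.forget v).map ((L.iota v ε).app X₀)) ≍
      ((L.lamOver v ν₁).hom.app X₀ ≫ (L.lamOver v ν₂).inv.app X₀))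
    (hpost : ∀ (v : Vmod) (ν₁ ν₂ : LogVertex (isArc v)) (ε : LogEdge (isArc v) ν₁ ν₂) (_ : ν₁.isPostLog = true)
      (_ : ν₂.isPostLog = false) (X₀ : L.X), (L.toE v).map ((L.forget v).map ((L.iota v ε).app X₀)) ≍
      ((L.lamOver v (LogVertex.spaceLink (isArc v))).hom.app (L.log.obj X₀) ≫ L.logOver.hom.app X₀ ≫
        (L.lamOver v ν₂).inv.app X₀)) :
    (∃ K : L.diagram.HomotopyFamily, L.RealisesCor55Families K) ∧ L.Cor55ShiftAction :=
  ⟨L.exists_realisesCor55Families_of_over (fun v ν _ => L.lamOver v ν) L.logOver hsq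
      (fun v ν₁ ν₂ ε h₁ h₂ X₀ => hpre v ν₁ ν₂ ε h₁ h₂ X₀) (fun v ν₁ ν₂ ε h₁ h₂ _ X₀ => hpost v ν₁ ν₂ ε h₁ h₂ X₀),
    L.cor55ShiftAction_of_over (fun v ν _ => L.lamOver v ν) L.logOver hsq
      (fun v ν₁ ν₂ ε h₁ h₂ X₀ => hpre v ν₁ ν₂ ε h₁ h₂ X₀) (fun v ν₁ ν₂ ε h₁ h₂ _ X₀ => hpost v ν₁ ν₂ ε h₁ h₂ X₀)⟩

end LogFrobeniusSetting

end Literature.AnabelianGeometry.AbsoluteAnabelian
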